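import Mathlib
import HarnessLib
import Literature.MathematicalPhysics.StatisticalMechanics.StrongNormExp
import Literature.MathematicalPhysics.StatisticalMechanics.HigherDerivativeForms
import Literature.MathematicalPhysics.StatisticalMechanics.WeightTowerStrong

/-!
# The strong weight `W_k^B = e^{½ g(φ, G φ)}`, `G = Σ_α L^{2k(|α|−1)}(∇^α)ᵀχ∇^α`, dominates the `ℓ²(B)`
# level of the field ([ABKM19] (9.14): `|φ|²_{k,ℓ²(B)} ≤ (φ, G_k^B φ)`)

The hypothesis `Ell2Dominates B 𝔥 R W` of `StrongNormExp` (Lemma 9.3) for the strong weights of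
[ABKM19] (7.6)/`WeightTowerStrong.expWeight`: if the index set `s` contains `linIndex d`, the density
`χ ≥ 0` is `≥ 1` on `B`, `R = L^k`, and the strong coefficient satisfies `g ≥ R²/(|B| 𝔥²)` (for the
ABKM parameters `R²/(|B|𝔥²) = h_k^{−2} = g_k` exactly), then
`W = expWeight (g • derivForm L k s χ)` dominates with `N² = (φ, derivForm φ) · R²/(|B|𝔥²)`.

* `sum_sq_iterDiff_le_derivForm` — `Σ_{x∈B} (∇^αφ(x))² ≤ L^{−2k(|α|−1)} (φ, derivForm L k s χ φ)` for `α ∈ s`;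
* **`ell2Dominates_expWeight_derivForm`**.

Everything is proved; no named fact.

## References
* S. Adams, S. Buchholz, R. Kotecký, S. Müller, arXiv:1910.13564, Ch. 7.1 (7.6), Lemma 9.3 (9.14)
  [AdamsBuchholzKoteckyMuller2019].
-/

noncomputable section

namespace Literature.MathematicalPhysics.StatisticalMechanics.GradientRG

open scoped BigOperators
open Finset Matrix
open Literature.MathematicalPhysics.StatisticalMechanics.GradientFRD (iterDiff fwdDiff)

variable {d M : ℕ} [NeZero M]

/-- **One term of the strong form controls the `ℓ²(B)` norm of `∇^αφ`**: for `α ∈ s`, `χ ≥ 0` with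
`χ ≥ 1` on `B`, `Σ_{x∈B} (∇^αφ(x))² ≤ L^{−2k(|α|−1)} (φ, derivForm L k s χ φ)` (`L > 0`).
[cite: AdamsBuchholzKoteckyMuller2019, Ch. 7.1 (7.6)] -/
theorem sum_sq_iterDiff_le_derivForm {L : ℝ} (hL : 0 < L) (k : ℕ) {s : Finset (Fin d → ℕ)}
    {α : Fin d → ℕ} (hα : α ∈ s) {χ : (Fin d → ZMod M) → ℝ} (hχ0 : ∀ x, 0 ≤ χ x)
    {B : Finset (Fin d → ZMod M)} (hχB : ∀ x ∈ B, 1 ≤ χ x) (φ : (Fin d → ZMod M) → ℝ) :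
    ∑ x ∈ B, iterDiff α φ x ^ 2 ≤
      (L ^ (2 * k * (∑ i, α i - 1)))⁻¹ * (φ ⬝ᵥ derivForm L k s χ *ᵥ φ) := by
  have hLp : 0 < L ^ (2 * k * (∑ i, α i - 1)) := pow_pos hL _
  rw [dotProduct_derivForm_mulVec]
  -- the `α`-term of the sum dominates `Σ_{x∈B} (∇^αφ x)²`
  have hterm : ∑ x ∈ B, iterDiff α φ x ^ 2 ≤ ∑ x, χ x * iterDiff α φ x ^ 2 := by
    calc ∑ x ∈ B, iterDiff α φ x ^ 2 ≤ ∑ x ∈ B, χ x * iterDiff α φ x ^ 2 :=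
          Finset.sum_le_sum fun x hx => le_mul_of_one_le_left (sq_nonneg _) (hχB x hx)
      _ ≤ ∑ x, χ x * iterDiff α φ x ^ 2 :=
          Finset.sum_le_univ_sum_of_nonneg fun x => mul_nonneg (hχ0 x) (sq_nonneg _)
  have hall : L ^ (2 * k * (∑ i, α i - 1)) * ∑ x, χ x * iterDiff α φ x ^ 2 ≤
      ∑ β ∈ s, L ^ (2 * k * (∑ i, β i - 1)) * ∑ x, χ x * iterDiff β φ x ^ 2 :=
    Finset.single_le_sum (f := fun β => L ^ (2 * k * (∑ i, β i - 1)) * ∑ x, χ x * iterDiff β φ x ^ 2)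
      (fun β _ => mul_nonneg (pow_nonneg hL.le _)
        (Finset.sum_nonneg fun x _ => mul_nonneg (hχ0 x) (sq_nonneg _))) hα
  rw [le_inv_mul_iff₀ hLp]
  exact (mul_le_mul_of_nonneg_left hterm hLp.le).trans hall

/-- **The strong weight dominates the `ℓ²` level** ([ABKM19] (9.14) `|φ|²_{k,ℓ²(B)} ≤ (φ, G_k^B φ)`):
`Ell2Dominates B 𝔥 (L^k) (expWeight (g • derivForm L k s χ))` when `linIndex d ⊆ s`, `χ ≥ 0`,
`χ ≥ 1` on `B ≠ ∅`, and `(L^k)² ≤ g · |B| · 𝔥²` (for the [ABKM19] parameters: `g = h_k^{−2}`).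
[cite: AdamsBuchholzKoteckyMuller2019, Lemma 9.3 (9.14)] -/
theorem ell2Dominates_expWeight_derivForm {L 𝔥 g : ℝ} (hL : 0 < L) (h𝔥 : 0 < 𝔥)
    (k : ℕ) {s : Finset (Fin d → ℕ)} (hlin : ∀ α : Fin d → ℕ, α ∈ linIndex d → α ∈ s)
    {χ : (Fin d → ZMod M) → ℝ} (hχ0 : ∀ x, 0 ≤ χ x) {B : Finset (Fin d → ZMod M)}
    (hB : B.Nonempty) (hχB : ∀ x ∈ B, 1 ≤ χ x) (hgB : (L ^ k) ^ 2 ≤ g * (B.card * 𝔥 ^ 2)) :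
    Ell2Dominates B 𝔥 (L ^ k) (expWeight (g • derivForm L k s χ)) := by
  intro φ
  set Q : ℝ := φ ⬝ᵥ derivForm L k s χ *ᵥ φ with hQ
  set n : ℝ := (B.card : ℝ) with hn
  have hn0 : 0 < n := by rw [hn]; exact_mod_cast hB.card_pos
  have hQ0 : 0 ≤ Q := by
    have h0 := (posSemidef_derivForm hL.le k s hχ0).dotProduct_mulVec_nonneg φ
    rwa [star_trivial] at h0
  set c : ℝ := (L ^ k) ^ 2 / (n * 𝔥 ^ 2) with hc
  have hc0 : 0 ≤ c := by positivity
  refine ⟨Real.sqrt (c * Q), Real.sqrt_nonneg _, fun α => ?_, fun i => ?_, ?_⟩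
  · -- linear multi-indices
    have hα1 : 1 ≤ ∑ i, (α : Fin d → ℕ) i := (mem_linIndex.1 α.2).1
    have hS := sum_sq_iterDiff_le_derivForm hL k (hlin _ α.2) hχ0 hχB φ
    have hrhs0 : 0 ≤ Real.sqrt (c * Q) * (Real.sqrt n * (𝔥 * ((L ^ k) ^ (∑ i, (α : Fin d → ℕ) i))⁻¹)) := by
      positivity
    rw [← Real.sqrt_sq hrhs0]
    refine Real.sqrt_le_sqrt (hS.trans ?_)
    rw [mul_pow, mul_pow, Real.sq_sqrt (mul_nonneg hc0 hQ0), Real.sq_sqrt hn0.le]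
    -- `L^{-2k(|α|-1)} Q ≤ c Q n 𝔥² (L^k)^{-2|α|}`, an identity up to `Q ≥ 0`
    have hpow : (L ^ (2 * k * (∑ i, (α : Fin d → ℕ) i - 1)))⁻¹ =
        c * (n * (𝔥 * ((L ^ k) ^ (∑ i, (α : Fin d → ℕ) i))⁻¹) ^ 2) := by
      rw [hc]
      have h𝔥0 : 𝔥 ≠ 0 := h𝔥.ne'
      have hL0 : L ≠ 0 := hL.ne'
      have hn0' : n ≠ 0 := hn0.ne'
      field_simp
      rw [← pow_mul, ← pow_mul, ← pow_mul, ← pow_add]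
      congr 1
      have : 1 ≤ ∑ i, (α : Fin d → ℕ) i := hα1
      zify [this] at *
      ring_nf
    rw [hpow]
    exact le_of_eq (by ring)
  · -- unit directions: `∇_i = ∇^{e_i}`, `e_i ∈ linIndex`
    have hmem : (Pi.single i 1 : Fin d → ℕ) ∈ linIndex d := by
      rw [mem_linIndex]; simp
    have hS := sum_sq_iterDiff_le_derivForm hL k (hlin _ hmem) hχ0 hχB φ
    have hsum : ∑ j, (Pi.single i 1 : Fin d → ℕ) j = 1 := by simp
    rw [hsum, Nat.sub_self, mul_zero, pow_zero, inv_one, one_mul] at hS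
    have hS' : ∑ x ∈ B, fwdDiff i φ x ^ 2 ≤ Q := by
      refine le_trans (le_of_eq (Finset.sum_congr rfl fun x _ => ?_)) hS
      rw [← iterDiff_single]
    have hrhs0 : 0 ≤ Real.sqrt (c * Q) * (Real.sqrt n * (𝔥 / L ^ k)) := by positivity
    rw [← Real.sqrt_sq hrhs0]
    refine Real.sqrt_le_sqrt (hS'.trans ?_)
    rw [mul_pow, mul_pow, Real.sq_sqrt (mul_nonneg hc0 hQ0), Real.sq_sqrt hn0.le]
    have hid : c * (n * (𝔥 / L ^ k) ^ 2) = 1 := by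
      rw [hc]
      have h𝔥0 : 𝔥 ≠ 0 := h𝔥.ne'
      have hL0 : L ^ k ≠ 0 := pow_ne_zero _ hL.ne'
      have hn0' : n ≠ 0 := hn0.ne'
      field_simp
    have hre : c * Q * (n * (𝔥 / L ^ k) ^ 2) = Q := by
      rw [show c * Q * (n * (𝔥 / L ^ k) ^ 2) = Q * (c * (n * (𝔥 / L ^ k) ^ 2)) by ring, hid, mul_one]
    rw [hre]
  · -- `e^{N²/2} ≤ e^{½ g Q}`
    rw [Real.sq_sqrt (mul_nonneg hc0 hQ0), expWeight, Matrix.smul_mulVec, dotProduct_smul, smul_eq_mul]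
    refine Real.exp_le_exp.2 ?_
    have hcg : c ≤ g := by
      rw [hc, div_le_iff₀ (by positivity)]; exact hgB
    have := mul_le_mul_of_nonneg_right hcg hQ0
    linarith

end Literature.MathematicalPhysics.StatisticalMechanics.GradientRG

end
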